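import Summits.BirchSwinnertonDyer.BirchSwinnertonDyer.Theorems.KolyvaginRoadThreeMethod2KolyvaginLocalFrobenius
import Summits.BirchSwinnertonDyer.BirchSwinnertonDyer.Theorems.Rank1ResidualJetKolyvaginFrobeniusTorsion
import HarnessLib

/-!
# T1 JET (cell `bsd-jet`), road K, input (L1) — brick C: at a Zhang–Kolyvagin prime `ℓ` of index
# `≥ k` the DECOMPOSITION GROUP of every prime `𝔓 ∣ λ = (ℓ)` of `\bar ℤ_K` fixes `E[p^k](K̄)`
# ("`λ` splits completely in `K(E[p^k])`")

HONEST FRAMING (programme file `BSD-LIT2PART-PROGRAMME-v1.md` §HONESTY, verbatim): «no tranche here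
proves BSD; ARM L moves the LITERAL column of an r ≤ 1 census into the kernel-proved-modulo-named-print
column; ARM P changes what «named print» is worth.» THEOREMS ONLY (seat `bsd-jet-pv-1`, session g6;
`--supports stmt-BirchSwinnertonDyer-14418`, helper): no definition, no named fact, no `sorry`.
Nothing is booked; 0 classes move.

## What

`K` imaginary quadratic, `E = W/ℚ` in global minimal form, `p` an odd prime, `k ≤ M(ℓ)` for a
Kolyvagin prime `ℓ` of W. Zhang (`Zhang2014.IsKolyvaginPrime`: `ℓ ∤ pN d_K`, `(ℓ)` prime in `𝓞 K`;
`le_kolyvaginIndex_iff`: `p^k ∣ ℓ + 1`, `p^k ∣ a_ℓ`), `w = λ` the place of `K` above `ℓ`, `𝔓 ∣ w` ANY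
prime of `\bar ℤ_K`. This generalises x11b3's `KolyLocal` file (koly g9; `p = 3`, `k = 1`, `𝔓` cut
out by the embedding into `\bar K_λ`) to level `p^k` and arbitrary `𝔓`:
* `hasGoodReductionAt_of_zhangKolyvaginPrime` — `E/K` has good reduction at `w`, and `w ∤ p^k`;
* `frob_smul_torsion_eq_self` — a `K`-Frobenius `F` at `𝔓` fixes `E[p^k](K̄)`: `res F = j·h'²`
  (`Iso.absGaloisRestrict_mul_inv_sq_mem_inertia`, `#𝓞_K/λ = ℓ²`), `j` inertial (trivial by good
  reduction, Silverman VII.4.1) and `h'² = 1` on `E[p^k](ℚ̄)` (brick B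
  `frob_smul_frob_smul_eq_self_of_dvd`), transported along `E[p^k](ℚ̄) ≃ E[p^k](K̄)`;
* `inertia_le_torsionFixing_of_zhangKolyvaginPrime` — `I_𝔓 ≤ Γ_{K(E[p^k])}` (VII.4.1 over `K`);
* **`smul_torsion_eq_self_of_mem_decompositionSubgroup`** / `decompositionSubgroup_le_torsionFixing`
  — the whole `G_𝔓 = ⟨F⟩·I_𝔓·Γ_{K(E[p^k])}` fixes `E[p^k](K̄)`
  (`LocalFrob.smul_eq_self_of_frob_smul_eq_self`).
Consumer: with `𝔓 = adicCompletionPrime K w` (`G_𝔓 = res Γ_{K_λ}`) the LOCAL Galois group acts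
trivially on `E[p^k]`, so `H¹(K_λ, E[p^k]) = Hom(Γ_{K_λ}, E[p^k])` and `H¹_ur ≅ E[p^k]` (bricks E/F).

References (locators only; no cited FACT is declared): [cite: GrossLMS1991, §3 (3.1)–(3.3), §4]
[cite: Jetchev2008, §3.2 (p. 815)] [cite: WZhang2014, Notations (xii)] [cite: NeukirchANT1999,
Ch. I §9 Prop. (9.4)–(9.6)] [cite: SilvermanAEC2009, Prop. VII.4.1]. Design: no definitions;
`K : Type`. Axioms: `propext`, `Classical.choice`, `Quot.sound`.
-/

set_option autoImplicit false

noncomputable section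

open scoped Classical Pointwise NumberField
open WeierstrassCurve Field Function NumberField IsDedekindDomain Rat.HeightOneSpectrum
open Literature.NumberTheory.EllipticCurves Literature.NumberTheory.GaloisRepresentations
open Summit.BirchSwinnertonDyer.Rank1Residual.X11b.Three.Koly.Method2

namespace Summit.BirchSwinnertonDyer.Rank1Residual.JET.GlobalDuality

section Decomposition

variable (W : WeierstrassCurve ℚ) (K : Type) [Field K] [NumberField K] [W.IsElliptic] [W.IsGloballyMinimal]

/-- **The place above a Kolyvagin prime is a place of good reduction of `E/K`, not above `p`**
(`ℓ ∤ N`, `ℓ ≠ p`). [cite: WZhang2014, Notations (xii)] -/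
theorem hasGoodReductionAt_of_zhangKolyvaginPrime {p : ℕ} [Fact p.Prime] {ℓ : ℕ}
    (hℓ : Zhang2014.IsKolyvaginPrime (W.conductorNorm ℤ) W K p ℓ)
    (w : HeightOneSpectrum (𝓞 K)) (hw : (ℓ : 𝓞 K) ∈ w.asIdeal) (k : ℕ) :
    (W.baseChange K).HasGoodReductionAt w ∧ ((((p ^ k : ℕ) : ℤ) : 𝓞 K) ∉ w.asIdeal) := by
  have hp : p.Prime := Fact.out
  obtain ⟨hℓprime, hℓN, -, hℓp, -, -⟩ := hℓ
  have hℓw : (ℓ : 𝓞 ℚ) ∈ (w.under (𝓞 ℚ)).asIdeal := by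
    change (ℓ : 𝓞 ℚ) ∈ w.asIdeal.under (𝓞 ℚ)
    rw [Ideal.under_def, Ideal.mem_comap, map_natCast]; exact hw
  haveI : w.asIdeal.LiesOver (w.under (𝓞 ℚ)).asIdeal := ⟨rfl⟩
  refine ⟨hasGoodReductionAt_baseChange_of_hasGoodReductionAt_rat W (w.under (𝓞 ℚ)) w
      (LocalFrob.hasGoodReductionAt_rat_of_not_dvd_conductorNorm W hℓprime hℓN _ hℓw), ?_⟩
  rw [Int.cast_natCast]
  exact not_mem_asIdeal_of_coprime K (((Nat.coprime_primes hℓprime hp).mpr hℓp).pow_right k) w hw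

/-- **A `K`-Frobenius at `𝔓 ∣ λ` acts trivially on `E[p^k](K̄)`** at a Zhang–Kolyvagin prime `ℓ`
with `k ≤ M(ℓ)`, for ANY prime `𝔓` of `\bar ℤ_K` above the place `w ∋ ℓ` (`K` imaginary quadratic,
`ℓ` inert): `res F = j · h'²` with `h'` a `ℚ`-Frobenius above `ℓ` (`h'² = 1` on `E[p^k](ℚ̄)`,
brick B) and `j` in the inertia group (trivial on `E[p^k]`, good reduction at `ℓ ≠ p`), transported
along `E[p^k](ℚ̄) ≃ E[p^k](K̄)`. Gross 1991 §3: `Frob λ = τ² = 1` on `E_{p^k}`.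
[cite: GrossLMS1991, §3 (3.2)–(3.3)] [cite: NeukirchANT1999, Ch. I §9 Prop. (9.4)]
[cite: SilvermanAEC2009, Prop. VII.4.1] -/
theorem frob_smul_torsion_eq_self (hK : IsImaginaryQuadratic K) {p : ℕ} [Fact p.Prime] {k ℓ : ℕ}
    (hℓ : Zhang2014.IsKolyvaginPrime (W.conductorNorm ℤ) W K p ℓ)
    (hk : k ≤ Zhang2014.kolyvaginIndex W p ℓ)
    (w : HeightOneSpectrum (𝓞 K)) (hw : (ℓ : 𝓞 K) ∈ w.asIdeal)
    {𝔓 : Ideal (absIntegers (𝓞 K) K)} (h𝔓 : 𝔓 ∈ w.primesAbove)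
    {F : absoluteGaloisGroup K} (hF : IsArithFrobAt (𝓞 K) F 𝔓)
    (Q : geomTorsion (W.baseChange K) ((p ^ k : ℕ) : ℤ)) : F • Q = Q := by
  have hp : p.Prime := Fact.out
  have hℓp : ℓ.Prime := hℓ.1
  have hℓp' : ℓ ≠ p := hℓ.2.2.2.1
  have hℓP : (Ideal.span {(ℓ : 𝓞 K)}).IsPrime := hℓ.2.2.2.2.1
  obtain ⟨h1, ha⟩ := (Zhang2014.le_kolyvaginIndex_iff (W := W) (p := p)).mp hk
  -- ### the place `v₁` of `ℚ` below `w`; good reduction at `ℓ ∤ N`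
  set v₁ : HeightOneSpectrum (𝓞 ℚ) := w.under (𝓞 ℚ) with hv₁
  have hwv₁ : w.asIdeal.under (𝓞 ℚ) = v₁.asIdeal := rfl
  have hℓv₁ : (ℓ : 𝓞 ℚ) ∈ v₁.asIdeal := by
    rw [← hwv₁, Ideal.under_def, Ideal.mem_comap, map_natCast]
    exact hw
  have hv₁ℓ : (primesEquiv v₁ : ℕ) = ℓ := primesEquiv_eq_of_natCast_mem hℓp hℓv₁
  have hgood₁ : W.HasGoodReductionAt v₁ :=
    LocalFrob.hasGoodReductionAt_rat_of_not_dvd_conductorNorm W hℓp hℓ.2.1 v₁ hℓv₁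
  -- ### the prime `𝔓' = 𝔓 ∩ \bar ℤ ∣ v₁`, a `ℚ`-Frobenius `h'` there; `res F = j · h'h'`
  set 𝔓' := 𝔓.comap (absIntegersMap ℚ K) with h𝔓'def
  have h𝔓' : 𝔓' ∈ v₁.primesAbove := comap_absIntegersMap_mem_primesAbove hwv₁ h𝔓
  haveI : 𝔓'.IsPrime := h𝔓'.1
  obtain ⟨h', hh'⟩ := HeightOneSpectrum.exists_isArithFrobAt_of_mem_primesAbove_holds h𝔓'
  have hj := Iso.absGaloisRestrict_mul_inv_sq_mem_inertia K hK.1 hℓp hℓP hw h𝔓 hF hℓv₁ h𝔓' hh'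
  -- `j` acts trivially on `E[p^k](ℚ̄)` (good reduction at `ℓ ≠ p`)
  have hpv₁ : ((((p ^ k : ℕ) : ℤ)) : 𝓞 ℚ) ∉ v₁.asIdeal := by
    rw [Int.cast_natCast]
    exact not_mem_asIdeal_of_coprime ℚ (((Nat.coprime_primes hℓp hp).mpr hℓp').pow_right k) v₁ hℓv₁
  have hjP : ∀ P : geomTorsion W ((p ^ k : ℕ) : ℤ),
      (absGaloisRestrict ℚ K F * (h' * h')⁻¹) • P = P :=
    fun P ↦ W.smul_geomTorsion_eq_of_mem_inertia hgood₁ hpv₁ h𝔓' hj P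
  -- ### `h'h' = 1` on `E[p^k](ℚ̄)` (brick B), hence `res F = 1` there
  have hne : ((primesEquiv v₁ : Nat.Primes) : ℕ) ≠ p := by rw [hv₁ℓ]; exact hℓp'
  have h1' : p ^ k ∣ ((primesEquiv v₁ : Nat.Primes) : ℕ) + 1 := by rw [hv₁ℓ]; exact h1
  have ha' : ((p ^ k : ℕ) : ℤ) ∣ W.frobeniusTrace (primesEquiv v₁) := by
    rw [hv₁ℓ]; exact_mod_cast ha
  have hres : ∀ P : geomTorsion W ((p ^ k : ℕ) : ℤ), absGaloisRestrict ℚ K F • P = P := fun P ↦ by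
    have e1 := hjP ((h' * h') • P)
    rw [smul_smul, inv_mul_cancel_right] at e1
    rw [e1, mul_smul]
    exact frob_smul_frob_smul_eq_self_of_dvd W p hne hgood₁ h1' ha' ⟨𝔓', h𝔓', hh'⟩ P
  -- ### transport to `E[p^k](K̄)`
  obtain ⟨P, rfl⟩ := (RatClosure.torsionEquiv (K := K) W ((p ^ k : ℕ) : ℤ)).surjective Q
  rw [← RatClosure.torsionEquiv_smul, hres]

/-- **The inertia group of `𝔓 ∣ λ` fixes `E[p^k](K̄)`** at a Kolyvagin prime (good reduction at
`λ ∤ p`; Silverman VII.4.1 over `K`). [cite: SilvermanAEC2009, Prop. VII.4.1] -/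
theorem inertia_le_torsionFixing_of_zhangKolyvaginPrime {p : ℕ} [Fact p.Prime] {ℓ : ℕ}
    (hℓ : Zhang2014.IsKolyvaginPrime (W.conductorNorm ℤ) W K p ℓ)
    (w : HeightOneSpectrum (𝓞 K)) (hw : (ℓ : 𝓞 K) ∈ w.asIdeal)
    {𝔓 : Ideal (absIntegers (𝓞 K) K)} (h𝔓 : 𝔓 ∈ w.primesAbove) (k : ℕ) :
    𝔓.inertia (absoluteGaloisGroup K) ≤ torsionFixing (W.baseChange K) ((p ^ k : ℕ) : ℤ) := by
  obtain ⟨hgood, hpw⟩ := hasGoodReductionAt_of_zhangKolyvaginPrime W K hℓ w hw k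
  intro i hi
  rw [mem_torsionFixing_iff]
  intro Q
  exact (W.baseChange K).smul_geomTorsion_eq_of_mem_inertia hgood hpw h𝔓 hi Q

/-- **The decomposition group `G_𝔓` of any prime `𝔓 ∣ λ` fixes `E[p^k](K̄)` pointwise** at a
Zhang–Kolyvagin prime `ℓ` with `k ≤ M(ℓ)` (`K` imaginary quadratic): `G_𝔓` is generated by a
Frobenius (`frob_smul_torsion_eq_self`), the inertia group (`inertia_le_torsionFixing_…`) and the
open subgroup `Γ_{K(E[p^k])}` (`LocalFrob.smul_eq_self_of_frob_smul_eq_self`). So `λ` splits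
completely in `K(E[p^k])/K` and `E[p^k] ⊆ E(K_λ)` — Gross 1991 §4 / McCallum Prop. 4.4 proof
("`E_{p^M} ⊂ E(K_λ)`"). [cite: GrossLMS1991, §3–§4] [cite: McCallumLMS1991, Prop. 4.4 (proof)]
[cite: NeukirchANT1999, Ch. I §9 Prop. (9.4)] -/
theorem smul_torsion_eq_self_of_mem_decompositionSubgroup (hK : IsImaginaryQuadratic K)
    {p : ℕ} [Fact p.Prime] {k ℓ : ℕ}
    (hℓ : Zhang2014.IsKolyvaginPrime (W.conductorNorm ℤ) W K p ℓ)
    (hk : k ≤ Zhang2014.kolyvaginIndex W p ℓ)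
    (w : HeightOneSpectrum (𝓞 K)) (hw : (ℓ : 𝓞 K) ∈ w.asIdeal)
    {𝔓 : Ideal (absIntegers (𝓞 K) K)} (h𝔓 : 𝔓 ∈ w.primesAbove)
    {d : absoluteGaloisGroup K} (hd : d ∈ 𝔓.decompositionSubgroup (absoluteGaloisGroup K))
    (Q : geomTorsion (W.baseChange K) ((p ^ k : ℕ) : ℤ)) : d • Q = Q := by
  have hp : p.Prime := Fact.out
  obtain ⟨F, hF⟩ := HeightOneSpectrum.exists_isArithFrobAt_of_mem_primesAbove_holds h𝔓
  have hn : ((p ^ k : ℕ) : ℤ) ≠ 0 := by exact_mod_cast pow_ne_zero k hp.ne_zero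
  exact LocalFrob.smul_eq_self_of_frob_smul_eq_self (W.baseChange K) h𝔓 hn hF
    (inertia_le_torsionFixing_of_zhangKolyvaginPrime W K hℓ w hw h𝔓 k)
    (frob_smul_torsion_eq_self W K hK hℓ hk w hw h𝔓 hF Q) hd

/-- The same as an inclusion: `G_𝔓 ≤ Γ_{K(E[p^k])}` (`torsionFixing`). [cite: GrossLMS1991, §3–§4] -/
theorem decompositionSubgroup_le_torsionFixing (hK : IsImaginaryQuadratic K) {p : ℕ} [Fact p.Prime]
    {k ℓ : ℕ} (hℓ : Zhang2014.IsKolyvaginPrime (W.conductorNorm ℤ) W K p ℓ)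
    (hk : k ≤ Zhang2014.kolyvaginIndex W p ℓ)
    (w : HeightOneSpectrum (𝓞 K)) (hw : (ℓ : 𝓞 K) ∈ w.asIdeal)
    {𝔓 : Ideal (absIntegers (𝓞 K) K)} (h𝔓 : 𝔓 ∈ w.primesAbove) :
    𝔓.decompositionSubgroup (absoluteGaloisGroup K) ≤ torsionFixing (W.baseChange K) ((p ^ k : ℕ) : ℤ) :=
  fun _ hd ↦ (mem_torsionFixing_iff _ _).mpr fun Q ↦
    smul_torsion_eq_self_of_mem_decompositionSubgroup W K hK hℓ hk w hw h𝔓 hd Q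

end Decomposition

end Summit.BirchSwinnertonDyer.Rank1Residual.JET.GlobalDuality

end
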